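import Summits.HodgeConjecture.HodgeConjecture.Theses.BiquadraticSecantLift
import Summits.HodgeConjecture.HodgeConjecture.Theorems.WeilTypeLadderVariationalLocal
import Summits.HodgeConjecture.HodgeConjecture.Theorems.HeckePrymWeilHyperbolicEightfoldsSqrtMinus7OfAnchorObject
import Literature.AlgebraicGeometry.HodgeTheory.WeilClassesCMReductionPolarized
import Literature.AlgebraicGeometry.HodgeTheory.WeilClassesFieldOneClass
import Literature.AlgebraicGeometry.HodgeTheory.WeilClassesFieldIsogenyInvariance
import Literature.AlgebraicGeometry.HodgeTheory.WeilClassesBlochSeed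
import Literature.AlgebraicGeometry.HodgeTheory.BlochSemiregularSpread
import Literature.AlgebraicGeometry.HodgeTheory.LefschetzOneOneHolds
import Literature.AlgebraicGeometry.HodgeTheory.IsoTransport
import HarnessLib
import HarnessLib.Audit

/-!
# Line `seed` for crux X1 `MarkmanBiquadraticTwelvefolds` (stmt-HodgeConjecture-22132) — OBJECT-LEVEL SEED + PROVED AMPLIFICATION

Second skeleton on the crux (the first is `Lines/birth.lean`, registered 2026-08-27). Nothing here proves the Hodge
conjecture, rung H2 `WeilSixfolds`, X1, X2, X3 or the rung `X1At 1 3`: the two load-bearing stubs are `sorry`.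

## Why a second line (audit of `birth`)
`birth` cuts X1 as REACH (`MarkmanReachAt`: ring 2's typed missing input pointed at a Markman member) ∧ ANCHOR
(`SecantAnchorAt`: SOME Markman member `(X₀ ⊞ X₀, η′, h)` of the split component has ALL its `L`-Weil classes algebraic) ∧
TRANSPORT (`SemiregularDeformAt`: one algebraic Markman fibre ⟹ every fibre). Its ANCHOR is CLASS-LEVEL and is INHABITED BY
PRODUCT/CM MEMBERS: for `X₀ = E^6` (`E` any elliptic curve), `θ = antidiag(m,1) ⊗ I₃` and a product polarization, `X₀ ⊞ X₀ ≅ E^{12}`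
has a divisor-generated Hodge ring, so every Weil class is algebraic there — this is exactly the tree's own CM anchor
`Deligne1982.exists_cmAnchor_of_isPolarizedHyperbolicWeilTypeCM` (a tensor point on a power of a CM elliptic curve: CM type,
ALL Hodge classes algebraic, `E`-isometric to the member and joined to it in `X⁺`). At such an anchor there is NO deformable
object (DOOR #3 of `pub-hsemireg/step0/C`: the induced/product point carries no semiregular representative that survives to the
generic member), so `birth`'s TRANSPORT degenerates to ring 2's open node `WeilVariationalHodgeComponentCM` (a case of HC) and the
three stubs carry no secant content between them. The research content of the route's lever (Markman's secant sheaf, or any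
semiregular / Bloch representative on ONE honest member) is an OBJECT-LEVEL SEED; this file types it and PROVES the rest.

## The cut (door B of the `K`-ladder, transposed to the CM cell `(L = ℚ[T]/(R_(d,m)(T²)), 2k = 6, δ split)`)
* `LocalClauseAt P h w` — the mechanism-agnostic LOCAL CLAUSE at a member `P` (shape of the tree's `WeilAnchorLocalClause`):
  along ANY smooth projective family of relative dimension `12` through `P` (quasi-projective total space, smooth irreducible
  quasi-projective base) carrying global classes `H` (fibrewise rational `(1,1)`, reading `h` at `P`) and `W` (fibrewise
  rational `(3,3)`, reading `w` at `P`), some `q·H_s³ + W_s` is ALGEBRAIC for `s` in a Euclidean-open `U ∋ s₀`.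
* `HasBlochSeedAt12 P h w` + PROVED bridge `localClauseAt_of_blochSpread_of_blochSeed` — the lci entrance: an integral local
  complete intersection `Z ⊂ P` of codimension `3`, Bloch-semiregular in the twelvefold, supporting `q·h³ + w`, gives the local
  clause granting the tree's REFEREED class-level Bloch theorem `BlochSemiregularSpread 12 3` (Bloch 1972 (7.4)/(7.5),
  Buchweitz–Flenner 2003 Thm. 5.2). (Markman's secant SHEAF is the other entrance: BF Thm. 5.1 for sheaves is not yet typed in
  the tree — `BlochSemiregularSpread` TODO —, so a sheaf seed is filed directly as `LocalClauseAt`.)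
* STUB `stub_seedAnchor : SeedAnchors` — ∃ a POLARIZED hyperbolic member `(P, η_P, h)` of the split `(L,6)`-component
  (Deligne Thm. 4.8 (a)+(b) binders, positivity included) with a non-zero rational `L`-Weil class `w` satisfying the local
  clause. THE research ∃ (size L; Markman 2025 treats `K` imaginary quadratic only).
* STUB `stub_seedReach : SeedReach` — Deligne's connected algebraic family of the component THROUGH the seeded member, reaching
  every class-level hyperbolic target `(B, η)` UP TO AN `L`-EQUIVARIANT ISOGENY `g : B ⟶ B' ≅ 𝒳_{s₁}`, with global `H`
  (polarization) and `W` (flat extension of `w`: monodromy in `SU(V,φ)` acts on `⋀⁶_L V` through `det = 1`; theorem of the fixed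
  part) whose value at `s₁` is a non-zero `L`-Weil class of `B'` (typed missing input MET IN PRINT: Deligne 1982 §4 proof of
  Thm. 4.8 + Lemma 4.6 + §5; Landherr; size M–L typing; includes the positivity supply for class-level targets).
* PROVED `x1At_of_seed : SeedAnchorAt d m → SeedReachAt d m → X1At d m`: local clause at `s₀` ⟹ open set of algebraic fibres ⟹
  ALL fibres algebraic (`mem_algebraicClasses_of_isOpen_subset_algebraicityLocus`, Charles–Schnell 11.3.11: countable union of
  closed algebraicity loci with interior) ⟹ `W_{s₁}` algebraic (subtract `q·H_{s₁}³`, Lefschetz (1,1) + Kleiman on the abelian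
  fibre) ⟹ `g^*W_{s₁}` is a non-zero rational algebraic `L`-Weil class on `B` ⟹ ALL of `W_L(B) ⊗ ℂ` algebraic (the tree's
  ONE-CLASS LEMMA `weilClassesField_le_algebraicClasses_of_isRationalClass_of_ne_zero`).
* RUNG `stub_rung_d1_m3 : X1At 1 3` (T3 PLAN-ONLY, same name and statement as in `birth`); its plan here is
  `rung_d1_m3_of_seedAt : SeedAnchorAt 1 3 → SeedReachAt 1 3 → X1At 1 3` (proved).

## References
[cite: Markman2025SecantRealMultiplication, Thm. 1.1.2, §10.2, §11.2 (preprint)] [cite: Markman2025SecantWeil, Thm. 1.5.1, §1.5]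
[cite: Bloch1972Semiregularity, Thm. (7.4), Remark (7.5)] [cite: BuchweitzFlenner2003, Thm. 5.1, Thm. 5.2, (8.1)]
[cite: Deligne1982HodgeCycles, §4 Cor. 4.2, Prop. 4.4, Lemma 4.6, proof of Thm. 4.8, §5] [cite: Landherr1936HermitianForms]
[cite: CharlesSchnell2014Notes, Prop. 11.3.11] [cite: vanGeemen1994HodgeAV, 3.6–3.7, Lemma 5.2] [cite: MoonenZarhin1998WeilClasses, §1]
[cite: Markman2025SurveySecant, §4] [cite: VoisinHodgeII2003, §9.2.4 Prop. 9.20]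
-/

noncomputable section

-- single-problem summit (Problem = Summit): the mandated namespace repeats `HodgeConjecture`.
set_option linter.dupNamespace false

open CategoryTheory CategoryTheory.Limits AlgebraicGeometry
open Literature.AlgebraicGeometry Literature.AlgebraicGeometry.Motives Literature.AlgebraicGeometry.HodgeTheory
open Literature.AlgebraicGeometry.Deligne1982
open Literature.AlgebraicTopology.SingularHomology
open Literature.AlgebraicGeometry.VanGeemen1994 (pullbackOne)
open Summit.HodgeConjecture.HodgeConjecture.WeilTypeLadder (mem_algebraicClasses_of_isOpen_subset_algebraicityLocus)
open Summit.HodgeConjecture.HodgeConjecture.Theorems.HyperbolicEightfoldsSqrtMinus7.AnchorObject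
  (cupPowTwo_mem_algebraicClasses_abelian)

namespace Summit.HodgeConjecture.HodgeConjecture.Cruxes.MarkmanBiquadraticTwelvefolds.Seed

/-! ## §0 Vocabulary (verbatim from `Lines/birth.lean`: the route's polynomial and the crux body at fixed `(d, m)`) -/

/-- `R_(d,m)(S) = S² + 2d(1+m)·S + d²(m-1)²` — LITERALLY the route's polynomial (`E = L = ℚ[T]/(R_(d,m)(T²)) = ℚ(√-d, √m)`). -/
def bqPoly (d m : ℕ) : Polynomial ℤ :=
  Polynomial.X ^ 2 + Polynomial.C (2 * (d : ℤ) * (1 + (m : ℤ))) * Polynomial.X +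
    Polynomial.C ((d : ℤ) ^ 2 * ((m : ℤ) - 1) ^ 2)

/-- **X1 at fixed `(d, m)`** — the crux's body with `R_(d,m) = bqPoly d m` (the RUNG `X1At 1 3` is its `(1,3)` instance). -/
def X1At (d m : ℕ) : Prop :=
  ∀ (B : AbelianVariety ℂ) (η : B ⟶ B), IsHyperbolicWeilTypeCM B η (bqPoly d m) 2 3 →
    ∀ c ∈ weilClassesField B η ((bqPoly d m).comp (Polynomial.X ^ 2)) 6,
      IsRationalClass c → IsOfHodgeType B.dim B.X 6 3 3 c → c ∈ algebraicClasses B.X 3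

/-! ## §1 The local clause at a member, and its lci (Bloch) entrance -/

/-- **LOCAL CLAUSE at a member `P` for the class data `(h, w)`** (mechanism-agnostic; the shape of the tree's
`WeilAnchorLocalClause` without its unused abelian-fibre clause, in relative dimension `12`, codimension `3`): along every smooth
projective family `f : 𝒳 ⟶ S` of relative dimension `12` with quasi-projective total space over a smooth irreducible
quasi-projective base, for all global classes `H ∈ H²(𝒳)` (fibrewise rational `(1,1)`) and `W ∈ H⁶(𝒳)` (fibrewise rational
`(3,3)`) and every chart `e' : P ≅ 𝒳_{s₀}` with `e'^*H_{s₀} = h`, `e'^*W_{s₀} = w`, there are a Euclidean-open `U ∋ s₀` and `q ∈ ℚ`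
with `q·H_s³ + W_s` ALGEBRAIC on `𝒳_s` for all `s ∈ U`. Outputs of: Bloch's theorem for an lci semiregular seed
(`localClauseAt_of_blochSpread_of_blochSeed`), Buchweitz–Flenner Thm. 5.1 for a semiregular SHEAF with `ch₃ = q·h³ + w`
(Markman's secant sheaf), the pro-representability criterion BF Thm. 4.9. PREDICATE, nothing asserted.
[cite: Bloch1972Semiregularity, Thm. (7.4)] [cite: BuchweitzFlenner2003, Thm. 5.1 and Thm. 5.2] [cite: Markman2025SecantWeil, §1.5] -/
def LocalClauseAt (P : AbelianVariety ℂ) (h : complexBetti P.X 2) (w : complexBetti P.X (2 * 3)) : Prop :=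
  ∀ ⦃𝒳 S : SchemeOver ℂ⦄ (f : 𝒳 ⟶ S), IsSmoothProjectiveFamily f (2 * 3 * 2) →
    IsQuasiProjectiveOver 𝒳 → IsQuasiProjectiveOver S → IrreducibleSpace S.left → AlgebraicGeometry.Smooth S.hom →
    ∀ (H : complexBetti 𝒳 2) (W : complexBetti 𝒳 (2 * 3)),
      (∀ s : ComplexPoints S, IsRationalClass (complexBetti.map (fiberι f s) 2 H) ∧
          IsOfHodgeType (2 * 3 * 2) (fiberOver f s) 2 1 1 (complexBetti.map (fiberι f s) 2 H)) →
      (∀ s : ComplexPoints S, IsRationalClass (complexBetti.map (fiberι f s) (2 * 3) W) ∧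
          IsOfHodgeType (2 * 3 * 2) (fiberOver f s) (2 * 3) 3 3 (complexBetti.map (fiberι f s) (2 * 3) W)) →
      ∀ (s₀ : ComplexPoints S) (e' : P.X ≅ fiberOver f s₀),
        complexBetti.map e'.hom 2 (complexBetti.map (fiberι f s₀) 2 H) = h →
        complexBetti.map e'.hom (2 * 3) (complexBetti.map (fiberι f s₀) (2 * 3) W) = w →
        ∃ (U : Set (ComplexPoints S)) (q : ℚ), IsOpen U ∧ s₀ ∈ U ∧
          ∀ s ∈ U, ((q : ℚ) : ℂ) • cupPowTwo (complexBetti.map (fiberι f s) 2 H) 3 +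
            complexBetti.map (fiberι f s) (2 * 3) W ∈ algebraicClasses (fiberOver f s) 3

/-- **A Bloch seed for `q·h³ + w` on the twelvefold `P`** (the tree's `HasBlochSeedAt` with the ambient read as a `12`-fold and
codimension `3` — `HasBlochSeedAt n` hard-codes codimension `n` in a `2n`-fold): an INTEGRAL local complete intersection
`i : Z ↪ P` of codimension `3`, Bloch-semiregular (`IsBlochSemiregular i 12 3`), with `q·h³ + w` supported on `Z`. PREDICATE.
[cite: Bloch1972Semiregularity, Thm. (7.4) and Remark (7.5)] [cite: BuchweitzFlenner2003, Thm. 5.2 and (8.1)] -/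
def HasBlochSeedAt12 (P : AbelianVariety ℂ) (h : complexBetti P.X 2) (w : complexBetti P.X (2 * 3)) : Prop :=
  ∃ (Z : Scheme.{0}) (i : Z ⟶ P.X.left) (q : ℚ),
    IsClosedImmersion i ∧ IsRegularImmersionOfCodim i 3 ∧ AlgebraicGeometry.IsIntegral Z ∧
    (∀ z ∈ Set.range i.base, ((3 : ℕ) : ℕ∞) ≤ Order.coheight z) ∧
    IsBlochSemiregular i (2 * 3 * 2) 3 ∧
    ((q : ℚ) : ℂ) • cupPowTwo h 3 + w ∈ classesSupportedOn P.X (Set.range i.base) (2 * 3)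

/-- **BRIDGE (proved): Bloch's theorem (class level, REFEREED fact `BlochSemiregularSpread 12 3`) ∧ a Bloch seed ⟹ the local
clause.** Verbatim transposition of the tree's `weilAnchorLocalClause_of_blochSpread_of_blochSeedAt` to `(12, 3)`.
[cite: Bloch1972Semiregularity, Thm. (7.4)] [cite: BuchweitzFlenner2003, Thm. 5.2] [cite: VoisinTorino1994, Lecture 7, Thm. 2.4] -/
theorem localClauseAt_of_blochSpread_of_blochSeed (hB : BlochSemiregularSpread (2 * 3 * 2) 3)
    {P : AbelianVariety ℂ} {h : complexBetti P.X 2} {w : complexBetti P.X (2 * 3)} (hS : HasBlochSeedAt12 P h w) :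
    LocalClauseAt P h w := by
  obtain ⟨Z, i, q, hi, hreg, hint, hcoh, hsr, hsupp⟩ := hS
  intro 𝒳 S f hf h𝒳qp hSqp _ hsm H W hH hW s₀ e' hH₀ hW₀
  set B : complexBetti 𝒳 (2 * 3) := ((q : ℚ) : ℂ) • cupPowTwo H 3 + W with hBdef
  have hres : ∀ s : ComplexPoints S, complexBetti.map (fiberι f s) (2 * 3) B =
      ((q : ℚ) : ℂ) • cupPowTwo (complexBetti.map (fiberι f s) 2 H) 3 + complexBetti.map (fiberι f s) (2 * 3) W := by
    intro s
    rw [hBdef, map_add, map_smul, complexBetti_map_cupPowTwo']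
  have hBrat : ∀ s : ComplexPoints S,
      IsRationalClass (complexBetti.map (fiberι f s) (2 * 3) B) ∧
        IsOfHodgeType (2 * 3 * 2) (fiberOver f s) (2 * 3) 3 3 (complexBetti.map (fiberι f s) (2 * 3) B) := by
    intro s
    rw [hres]
    exact ⟨(((hH s).1.cupPowTwo 3).smul q).add (hW s).1,
      ((isOfHodgeType_cupPowTwo (hf.isSmoothProjective s) (hH s).2 3).smul _).add (hf.isSmoothProjective s) (hW s).2⟩
  have hx : complexBetti.map e'.hom (2 * 3) (complexBetti.map (fiberι f s₀) (2 * 3) B) =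
      ((q : ℚ) : ℂ) • cupPowTwo h 3 + w := by
    rw [hres, map_add, map_smul, complexBetti_map_cupPowTwo', hH₀, hW₀]
  obtain ⟨U, hUo, hs₀U, hU⟩ :=
    hB P.X Z i (((q : ℚ) : ℂ) • cupPowTwo h 3 + w) 𝒳 S f s₀ e' B hi hreg hint hcoh hsr hsupp hf h𝒳qp hSqp hsm hBrat hx
  refine ⟨U, q, hUo, hs₀U, fun s hs => ?_⟩
  rw [← hres]
  exact hU s hs

/-! ## §2 The two stubs' statements at fixed `(d, m)`: SEED (object-level anchor) and REACH (Deligne's family, up to isogeny) -/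

/-- **SEED at `(d, m)`** — a SEEDED POLARIZED HYPERBOLIC MEMBER of the split `(L,6)`-component: `(P, η_P)` of Weil type for
`L = ℚ[T]/(R_(d,m)(T²))` of `L`-rank `6` (`IsWeilTypeCM P η_P R 2 3`) with a class `h` which is a polarization class some real
multiple of which is KÄHLER (Deligne Thm. 4.8: a genuine polarization), whose Rosati involution is complex conjugation on `L`,
of SPLIT discriminant and with an `η_P^*`-stable rational Lagrangian (Cor. 4.2 (a)(b)) — the binders of the tree's
`IsPolarizedHyperbolicWeilTypeCM`, unbundled to name `h` —, a NON-ZERO RATIONAL `L`-Weil class `w ∈ W_L(P) ⊗ ℂ`, and the LOCAL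
CLAUSE for `(h, w)`. Candidate: Markman's `P = X ⊞ X̂` with the secant sheaf (his Thm. 1.1.2 is the `K`-case; the `L`-Weil
line inside `HW(X × X̂, η̂)` is the route's bet) or an lci Bloch seed via `localClauseAt_of_blochSpread_of_blochSeed`. OPEN. -/
def SeedAnchorAt (d m : ℕ) : Prop :=
  ∃ (P : AbelianVariety ℂ) (ηP : P ⟶ P) (hW : IsWeilTypeCM P ηP (bqPoly d m) 2 3) (h : complexBetti P.X 2)
    (w : complexBetti P.X (2 * 3)),
    IsPolarizationClass P.dim P.X h ∧
    (∃ s : ℝ, s ≠ 0 ∧ IsKaehlerClass P.dim P.X ((s : ℂ) • h)) ∧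
    (∀ x y : complexBetti P.X 1,
      polarizationPairingOne P.X h (P.dim - 1) (pullbackOne P ηP x) y =
        -polarizationPairingOne P.X h (P.dim - 1) x (pullbackOne P ηP y)) ∧
    (haveI : Fact (Irreducible (realPolyQ (bqPoly d m))) := hW.fact_irreducible_map_real
     HasWeilDiscriminantCM P ηP (bqPoly d m) 2 3 h (splitDiscriminantClassCM (bqPoly d m) 3)) ∧
    IsHyperbolicWeilType P ηP (3 * 2) h ∧
    w ∈ weilClassesField P ηP ((bqPoly d m).comp (Polynomial.X ^ 2)) (2 * 3) ∧ IsRationalClass w ∧ w ≠ 0 ∧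
    LocalClauseAt P h w

/-- **lci SEED at `(d, m)`**: the same member data with a BLOCH SEED (`HasBlochSeedAt12`) in place of the local clause. -/
def BlochSeedAt (d m : ℕ) : Prop :=
  ∃ (P : AbelianVariety ℂ) (ηP : P ⟶ P) (hW : IsWeilTypeCM P ηP (bqPoly d m) 2 3) (h : complexBetti P.X 2)
    (w : complexBetti P.X (2 * 3)),
    IsPolarizationClass P.dim P.X h ∧
    (∃ s : ℝ, s ≠ 0 ∧ IsKaehlerClass P.dim P.X ((s : ℂ) • h)) ∧
    (∀ x y : complexBetti P.X 1,
      polarizationPairingOne P.X h (P.dim - 1) (pullbackOne P ηP x) y =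
        -polarizationPairingOne P.X h (P.dim - 1) x (pullbackOne P ηP y)) ∧
    (haveI : Fact (Irreducible (realPolyQ (bqPoly d m))) := hW.fact_irreducible_map_real
     HasWeilDiscriminantCM P ηP (bqPoly d m) 2 3 h (splitDiscriminantClassCM (bqPoly d m) 3)) ∧
    IsHyperbolicWeilType P ηP (3 * 2) h ∧
    w ∈ weilClassesField P ηP ((bqPoly d m).comp (Polynomial.X ^ 2)) (2 * 3) ∧ IsRationalClass w ∧ w ≠ 0 ∧
    HasBlochSeedAt12 P h w

/-- An lci seed is a seed, granting Bloch's class-level theorem for `(12, 3)` (proved). [cite: Bloch1972Semiregularity, Thm. (7.4)] -/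
theorem seedAnchorAt_of_blochSpread_of_blochSeedAt {d m : ℕ} (hB : BlochSemiregularSpread (2 * 3 * 2) 3)
    (hS : BlochSeedAt d m) : SeedAnchorAt d m := by
  obtain ⟨P, ηP, hW, h, w, hpol, hkae, hros, hdisc, hlag, hwW, hwQ, hw0, hseed⟩ := hS
  exact ⟨P, ηP, hW, h, w, hpol, hkae, hros, hdisc, hlag, hwW, hwQ, hw0, localClauseAt_of_blochSpread_of_blochSeed hB hseed⟩

/-- **REACH at `(d, m)`** — DELIGNE'S FAMILY THROUGH THE SEEDED MEMBER, UP TO ISOGENY AT THE TARGET: for every seeded polarized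
hyperbolic member `(P, η_P, h, w)` as in `SeedAnchorAt` and every class-level hyperbolic target `(B, η)` of the same split
`(L,6)`-type (`IsHyperbolicWeilTypeCM B η R 2 3`, the crux's hypothesis), there are a smooth projective family `f : 𝒳 ⟶ S` of
relative dimension `12` (quasi-projective total space, smooth irreducible quasi-projective base: a neat level cover of the
connected Shimura variety `Γ\X⁺` of `(H₁(P,ℚ), L, φ_h)` with its universal abelian scheme), a chart `e' : P ≅ 𝒳_{s₀}`, an
abelian variety `B'` with `η'` and an `L`-EQUIVARIANT ISOGENY `g : B ⟶ B'` (`g ≫ η' = η ≫ g`; Landherr: same rank, split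
discriminant and signatures ⟹ `H₁(B,ℚ) ≅ H₁(P,ℚ)` as hermitian `L`-spaces; positivity for class-level targets: Deligne §5 /
`f ↦ f·φ`, `f⁶ ∈ N(L^×)`), a chart `e₁ : B' ≅ 𝒳_{s₁}`, and global classes `H ∈ H²(𝒳)` (the universal polarization: fibrewise
rational `(1,1)`, `e'^*H_{s₀} = h`) and `W ∈ H⁶(𝒳)` (fibrewise rational `(3,3)`: the flat extension of `w` — monodromy
`Γ ⊂ SU(V,φ)` acts on `⋀⁶_L V` by `det_L = 1`, every fibre is of Weil type so `⋀⁶_L H¹ ⊂ H^{3,3}` (Prop. 4.4), theorem of the fixed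
part —, `e'^*W_{s₀} = w`) such that `e₁^*W_{s₁}` is a NON-ZERO element of `W_L(B', η') ⊗ ℂ`. A TYPED MISSING INPUT MET IN PRINT
(size M–L typing on the carriers; the `K`-analogue is the tree's named fact `weilFamilyReach_hyperbolic`).
[cite: Deligne1982HodgeCycles, §4 Prop. 4.4, Lemma 4.6, proof of Thm. 4.8 (pp. 32–34), §5] [cite: Landherr1936HermitianForms]
[cite: vanGeemen1994HodgeAV, 5.4–5.5 and proof of Lemma 5.2] [cite: Milne2020HodgeClassesAV, §2 2.1] -/
def SeedReachAt (d m : ℕ) : Prop :=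
  ∀ (P : AbelianVariety ℂ) (ηP : P ⟶ P) (h : complexBetti P.X 2) (w : complexBetti P.X (2 * 3))
    [Fact (Irreducible (realPolyQ (bqPoly d m)))],
    IsWeilTypeCM P ηP (bqPoly d m) 2 3 → IsPolarizationClass P.dim P.X h →
    (∃ s : ℝ, s ≠ 0 ∧ IsKaehlerClass P.dim P.X ((s : ℂ) • h)) →
    (∀ x y : complexBetti P.X 1,
      polarizationPairingOne P.X h (P.dim - 1) (pullbackOne P ηP x) y =
        -polarizationPairingOne P.X h (P.dim - 1) x (pullbackOne P ηP y)) →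
    HasWeilDiscriminantCM P ηP (bqPoly d m) 2 3 h (splitDiscriminantClassCM (bqPoly d m) 3) →
    IsHyperbolicWeilType P ηP (3 * 2) h →
    w ∈ weilClassesField P ηP ((bqPoly d m).comp (Polynomial.X ^ 2)) (2 * 3) → IsRationalClass w → w ≠ 0 →
    ∀ (B : AbelianVariety ℂ) (η : B ⟶ B), IsHyperbolicWeilTypeCM B η (bqPoly d m) 2 3 →
      ∃ (𝒳 S : SchemeOver ℂ) (f : 𝒳 ⟶ S) (s₀ s₁ : ComplexPoints S) (e' : P.X ≅ fiberOver f s₀)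
        (B' : AbelianVariety ℂ) (η' : B' ⟶ B') (g : B ⟶ B') (e₁ : B'.X ≅ fiberOver f s₁)
        (H : complexBetti 𝒳 2) (W : complexBetti 𝒳 (2 * 3)),
        IsSmoothProjectiveFamily f (2 * 3 * 2) ∧ IsQuasiProjectiveOver 𝒳 ∧ IsQuasiProjectiveOver S ∧
        IrreducibleSpace S.left ∧ AlgebraicGeometry.Smooth S.hom ∧
        (∀ s : ComplexPoints S, IsRationalClass (complexBetti.map (fiberι f s) 2 H) ∧
            IsOfHodgeType (2 * 3 * 2) (fiberOver f s) 2 1 1 (complexBetti.map (fiberι f s) 2 H)) ∧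
        (∀ s : ComplexPoints S, IsRationalClass (complexBetti.map (fiberι f s) (2 * 3) W) ∧
            IsOfHodgeType (2 * 3 * 2) (fiberOver f s) (2 * 3) 3 3 (complexBetti.map (fiberι f s) (2 * 3) W)) ∧
        complexBetti.map e'.hom 2 (complexBetti.map (fiberι f s₀) 2 H) = h ∧
        complexBetti.map e'.hom (2 * 3) (complexBetti.map (fiberι f s₀) (2 * 3) W) = w ∧
        AbelianVariety.IsIsogeny g ∧ g ≫ η' = η ≫ g ∧ B'.dim = 2 * 3 * 2 ∧
        complexBetti.map e₁.hom (2 * 3) (complexBetti.map (fiberι f s₁) (2 * 3) W) ∈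
          weilClassesField B' η' ((bqPoly d m).comp (Polynomial.X ^ 2)) (2 * 3) ∧
        complexBetti.map e₁.hom (2 * 3) (complexBetti.map (fiberι f s₁) (2 * 3) W) ≠ 0

/-- SEED, all `(d, m)` (the registered stub's statement). -/
def SeedAnchors : Prop := ∀ d m : ℕ, 0 < d → 0 < m → ¬ IsSquare m → SeedAnchorAt d m

/-- lci SEED, all `(d, m)`. -/
def BlochSeeds : Prop := ∀ d m : ℕ, 0 < d → 0 < m → ¬ IsSquare m → BlochSeedAt d m

/-- REACH, all `(d, m)` (the registered stub's statement). -/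
def SeedReach : Prop := ∀ d m : ℕ, 0 < d → 0 < m → ¬ IsSquare m → SeedReachAt d m

/-- X1 for all `(d, m)` in the rung spelling (definitionally the crux; kept as a local name so that exactly ONE theorem of
this file concludes the crux decl by name). -/
def X1All : Prop := ∀ d m : ℕ, 0 < d → 0 < m → ¬ IsSquare m → X1At d m

/-! ## §3 Registered stubs -/

/-- **STUB SEED (rank: hardest; size L; OPEN).** A seeded polarized hyperbolic member of every split biquadratic
`(L,6)`-component. WHY IT MIGHT FAIL: Markman's semiregular secant sheaf is built for `K = ℚ(√-d)` only (twisted by a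
2-form); on `X ⊞ X̂` with real multiplication the `L`-Weil LINE `⋀⁶_L H¹` sits inside the 20-dimensional `K`-Weil space and no
semiregular object with `ch₃ ∈ ℚ h³ + W_L` is known; an lci Bloch seed in codimension `3` on an abelian 12-fold is equally
unknown (complete intersections of divisors give only `h³`-type classes). [cite: Markman2025SecantRealMultiplication, §11.2]
[cite: Markman2025SecantWeil, §1.5] [cite: Bloch1972Semiregularity, Remark (7.5)] -/
theorem stub_seedAnchor : SeedAnchors := by
  sorry

/-- **STUB REACH (size M–L typing; MET IN PRINT).** Deligne's family through the seeded member reaching every hyperbolic target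
up to `L`-isogeny, with flat `W`. WHY IT MIGHT FAIL (as typed): only through the carriers — `IsSmoothProjectiveFamily` /
`IsQuasiProjectiveOver` for the universal abelian scheme over a neat level cover, and the positivity supply for a class-level
hyperbolic target with large endomorphism algebra (an isogenous `B'` with a genuine split `L`-polarization must be chosen).
[cite: Deligne1982HodgeCycles, §4 proof of Thm. 4.8, Lemma 4.6, §5] [cite: Landherr1936HermitianForms] -/
theorem stub_seedReach : SeedReach := by
  sorry

/-- **RUNG (T3 PLAN-ONLY; same name and statement as `Birth.stub_rung_d1_m3`)**: X1 at `(d, m) = (1, 3)`, `L = ℚ(i, √3) = ℚ(ζ₁₂)`.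
PLAN on this line: `rung_d1_m3_of_seedAt` — prove `SeedAnchorAt 1 3` (one seeded member of the `ℚ(ζ₁₂)` split component) and
`SeedReachAt 1 3`. NOT PROVED. [cite: Markman2025SecantRealMultiplication, Thm. 1.1.2] -/
theorem stub_rung_d1_m3 : X1At 1 3 := by
  sorry

/-! ## §4 PROVED amplification: SEED ∧ REACH ⟹ X1 (at fixed `(d, m)`, for all `(d, m)`, the rung plan, the crux BY NAME) -/

/-- **AMPLIFICATION AT FIXED `(d, m)` (no sorry).** Local clause at the seeded fibre ⟹ a Euclidean-open set of algebraic fibres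
⟹ every fibre algebraic (algebraicity locus = countable union of closed algebraic subsets, one with interior) ⟹ `W_{s₁}` algebraic
(Lefschetz (1,1) and Kleiman for `q·H_{s₁}³` on the abelian fibre) ⟹ `g^*W_{s₁}` is a non-zero rational algebraic class of
`W_L(B) ⊗ ℂ` ⟹ all of `W_L(B) ⊗ ℂ` is algebraic (one-class lemma). [cite: CharlesSchnell2014Notes, Prop. 11.3.11]
[cite: Markman2025SurveySecant, §4] [cite: vanGeemen1994HodgeAV, 3.6–3.7] [cite: VoisinHodgeII2003, §9.2.4 Prop. 9.20] -/
theorem x1At_of_seed (d m : ℕ) (hA : SeedAnchorAt d m) (hR : SeedReachAt d m) : X1At d m := by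
  intro B η hH c hc hcQ _
  have hW : IsWeilTypeCM B η (bqPoly d m) 2 3 := hH.isWeilTypeCM
  obtain ⟨P, ηP, hWP, h, w, hpol, hkae, hros, hdisc, hlag, hwW, hwQ, hw0, hloc⟩ := hA
  haveI : Fact (Irreducible (realPolyQ (bqPoly d m))) := hWP.fact_irreducible_map_real
  obtain ⟨𝒳, S, f, s₀, s₁, e', B', η', g, e₁, H, W, hf, h𝒳, hS, hirr, hsm, hHfib, hWfib, hH₀, hW₀, hgi, hgc, hB'dim,
      hW₁mem, hW₁ne⟩ :=
    hR P ηP h w hWP hpol hkae hros hdisc hlag hwW hwQ hw0 B η hH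
  haveI := hirr
  -- (1) the local clause at the seeded fibre `s₀`
  obtain ⟨U, q, hUo, hs₀U, hUalg⟩ := hloc f hf h𝒳 hS hirr hsm H W hHfib hWfib s₀ e' hH₀ hW₀
  -- (2) the global class `q·H³ + W` is algebraic on an open set of fibres, hence on every fibre
  set Bq : complexBetti 𝒳 (2 * 3) := ((q : ℚ) : ℂ) • cupPowTwo H 3 + W with hBqdef
  have hres : ∀ s : ComplexPoints S, complexBetti.map (fiberι f s) (2 * 3) Bq =
      ((q : ℚ) : ℂ) • cupPowTwo (complexBetti.map (fiberι f s) 2 H) 3 + complexBetti.map (fiberι f s) (2 * 3) W := by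
    intro s
    rw [hBqdef, map_add, map_smul, complexBetti_map_cupPowTwo']
  have hUalg' : ∀ t ∈ U, complexBetti.map (fiberι f t) (2 * 3) Bq ∈ algebraicClasses (fiberOver f t) 3 := by
    intro t ht
    rw [hres]
    exact hUalg t ht
  have hall := mem_algebraicClasses_of_isOpen_subset_algebraicityLocus f h𝒳 hS hsm hf Bq hUo ⟨s₀, hs₀U⟩ hUalg'
  have halg₁ : ((q : ℚ) : ℂ) • cupPowTwo (complexBetti.map (fiberι f s₁) 2 H) 3 +
      complexBetti.map (fiberι f s₁) (2 * 3) W ∈ algebraicClasses (fiberOver f s₁) 3 := by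
    rw [← hres]
    exact hall s₁
  -- (3) `H_{s₁}³` is algebraic (Lefschetz (1,1) + Kleiman on the abelian variety `B' ≅ 𝒳_{s₁}`), hence so is `W_{s₁}`
  have hB'sp : IsSmoothProjective (2 * 3 * 2) B'.X := by
    have h' : IsSmoothProjective B'.dim B'.X := AbelianVariety.isSmoothProjective_holds (A := B')
    rwa [hB'dim] at h'
  have hh₁ : complexBetti.map e₁.hom 2 (complexBetti.map (fiberι f s₁) 2 H) ∈ algebraicClasses B'.X 1 :=
    lefschetzOneOne_rational_holds hB'sp _ ((isRationalClass_map_iff_of_iso e₁).2 (hHfib s₁).1)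
      ((isOfHodgeType_map_iff_of_iso e₁).2 (hHfib s₁).2)
  have hh₃ : complexBetti.map e₁.hom (2 * 3) (cupPowTwo (complexBetti.map (fiberι f s₁) 2 H) 3) ∈
      algebraicClasses B'.X 3 := by
    rw [complexBetti_map_cupPowTwo']
    exact cupPowTwo_mem_algebraicClasses_abelian B' hh₁ 2
  have hH₃ : cupPowTwo (complexBetti.map (fiberι f s₁) 2 H) 3 ∈ algebraicClasses (fiberOver f s₁) 3 :=
    (mem_algebraicClasses_map_iff_of_iso e₁).1 hh₃
  have hW₁ : complexBetti.map (fiberι f s₁) (2 * 3) W ∈ algebraicClasses (fiberOver f s₁) 3 := by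
    have h' := Submodule.sub_mem _ halg₁ (Submodule.smul_mem _ ((q : ℚ) : ℂ) hH₃)
    rwa [add_sub_cancel_left] at h'
  -- (4) transport `W_{s₁}` to `B'` (chart) and to `B` (the `L`-equivariant isogeny `g`)
  set w₁ : complexBetti B'.X (2 * 3) := complexBetti.map e₁.hom (2 * 3) (complexBetti.map (fiberι f s₁) (2 * 3) W)
    with hw₁def
  have hw₁alg : w₁ ∈ algebraicClasses B'.X 3 := (mem_algebraicClasses_map_iff_of_iso e₁).2 hW₁
  have hw₁Q : IsRationalClass w₁ := (isRationalClass_map_iff_of_iso e₁).2 (hWfib s₁).1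
  have hBsp : IsSmoothProjective B.dim B.X := AbelianVariety.isSmoothProjective_holds (A := B)
  have hgw : complexBetti.map g.hom.hom.hom (2 * 3) w₁ ∈ weilClassesField B η ((bqPoly d m).comp (Polynomial.X ^ 2)) (2 * 3) :=
    map_mem_weilClassesField_of_comm hgc hW₁mem
  have hgwQ : IsRationalClass (complexBetti.map g.hom.hom.hom (2 * 3) w₁) := hw₁Q.map _
  have hgwalg : complexBetti.map g.hom.hom.hom (2 * 3) w₁ ∈ algebraicClasses B.X 3 :=
    map_mem_algebraicClasses_of_abelianVariety hBsp B' g.hom.hom.hom hw₁alg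
  have hgw0 : complexBetti.map g.hom.hom.hom (2 * 3) w₁ ≠ 0 := fun h0 =>
    hW₁ne ((complexBetti_map_bijective_of_isIsogeny hgi (2 * 3)).1 (h0.trans (map_zero _).symm))
  -- (5) one non-zero rational algebraic Weil class suffices
  have hle := weilClassesField_le_algebraicClasses_of_isRationalClass_of_ne_zero hW.natDegree_comp hW.irreducible
    hW.eval₂_eq_zero hW.degree_mul_rank hW.k_pos hgw hgwQ hgw0 hgwalg
  exact hle hc

/-- lci variant: Bloch's class-level theorem for `(12, 3)` ∧ an lci seed ∧ REACH ⟹ X1 at `(d, m)` (proved). -/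
theorem x1At_of_blochSeed (d m : ℕ) (hB : BlochSemiregularSpread (2 * 3 * 2) 3) (hS : BlochSeedAt d m)
    (hR : SeedReachAt d m) : X1At d m :=
  x1At_of_seed d m (seedAnchorAt_of_blochSpread_of_blochSeedAt hB hS) hR

/-- **THE RUNG'S PLAN on this line (proved): `SeedAnchorAt 1 3 → SeedReachAt 1 3 → X1At 1 3`.** -/
theorem rung_d1_m3_of_seedAt (hA : SeedAnchorAt 1 3) (hR : SeedReachAt 1 3) : X1At 1 3 :=
  x1At_of_seed 1 3 hA hR

/-- SEED ∧ REACH for all `(d, m)` ⟹ X1 for all `(d, m)` (proved). -/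
theorem x1All_of_seed (hA : SeedAnchors) (hR : SeedReach) : X1All :=
  fun d m hd hm hsq => x1At_of_seed d m (hA d m hd hm hsq) (hR d m hd hm hsq)

/-- `X1All` IS the crux (definitional: `bqPoly d m` is the route's polynomial, `6 = 2·3`). -/
theorem x1All_iff : X1All ↔ Summit.HodgeConjecture.HodgeConjecture.Theses.BiquadraticSecantLift.MarkmanBiquadraticTwelvefolds :=
  ⟨fun h d m hd hm hsq B η hH c hc hcQ hcH => h d m hd hm hsq B η hH c hc hcQ hcH,
    fun h d m hd hm hsq B η hH c hc hcQ hcH => h d m hd hm hsq B η hH c hc hcQ hcH⟩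

/-- **COMPOSITION — concludes the crux BY NAME from the registered stubs** (sorries live only inside `stub_seedAnchor`,
`stub_seedReach`): `stub_seedAnchor → stub_seedReach → MarkmanBiquadraticTwelvefolds` via `x1All_of_seed`. -/
theorem MarkmanBiquadraticTwelvefolds_of_stubs :
    Summit.HodgeConjecture.HodgeConjecture.Theses.BiquadraticSecantLift.MarkmanBiquadraticTwelvefolds :=
  x1All_iff.1 (x1All_of_seed stub_seedAnchor stub_seedReach)

end Summit.HodgeConjecture.HodgeConjecture.Cruxes.MarkmanBiquadraticTwelvefolds.Seed

end
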